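/-
Copyright: pub-rosobs cell (Resolution Observatory), carver gen 39.  Companion file; statements OURS, in
the cell's polynomial weighted-centre model `W(f)`.  Instrument — NOT a resolution theorem.
-/
import Literature.AlgebraicGeometry.Resolution.WeightedCentreAxisGenericPoint
import HarnessLib

/-!
# Maxima of `W(f)` for the one-term blocks `X_i^q` and `X_i X_j`

[cite: AbramovichTemkinWlodarczyk2024, Thm. 5.3.1 (2) (p. 1578): `inv = max (b₁,…,b_k)` over admissible
centres; §5.1 (p. 1575): admissibility via the monomial valuation].

The two blocks that occur, next to the umbrella `X_i^p + X_j^m X_l`, as variable-disjoint summands of the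
normal forms of the cell's census (`z^q`, `z₂ z₃`): in any number of ambient variables and every
characteristic, `max W(X_i^q) = (q)` (`isMaxInv_X_pow`) and `max W(X_i X_j) = (2, 2)` (`isMaxInv_X_mul_X`).
Both are the `τ`-prefix bound (`singleton_prefix_or_lt` / `replicate_prefix_or_lt`) plus an explicit
coordinate centre; the point of recording them is that every BLOCK value entering the observed
"sorted-merge" pattern for variable-disjoint sums is now a kernel fact, while the merge rule itself is not
claimed here.
-/

noncomputable section

open MvPolynomial

namespace Literature.AlgebraicGeometry.Resolution.WeightedBlowup

variable {k : Type*} [Field k] {N : ℕ}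

/-! ## The block `X_i^q` -/

/-- Weights of the coordinate centre `(X_i^q)`: `1/q` on `i`, `0` elsewhere (plumbing). [folklore] -/
def singleWeights (i : Fin N) (q : ℕ) : Fin N → ℚ := fun x => if x = i then (q : ℚ)⁻¹ else 0

/-- `exps` of the centre `(X_i^q)` is `(q)`. [cite: AbramovichTemkinWlodarczyk2024, §5.1 (p. 1575)] -/
theorem exps_singleWeights (i : Fin N) {q : ℕ} (hq : 0 < q) : exps (singleWeights i q) = [(q : ℚ)] := by
  classical
  have hq' : (q : ℚ) ≠ 0 := by exact_mod_cast hq.ne'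
  have hfilter : (Finset.univ.filter fun x => singleWeights i q x ≠ 0) = {i} := by
    ext x
    simp only [Finset.mem_filter, Finset.mem_univ, true_and, Finset.mem_singleton, singleWeights]
    constructor
    · intro h
      by_contra hx
      exact h (if_neg hx)
    · rintro rfl
      rw [if_pos rfl]
      exact inv_ne_zero hq'
  unfold exps
  rw [hfilter, Finset.toList_singleton]
  simp [singleWeights]

/-- The coordinate centre `(X_i^q)` is admissible for `X_i^q`. [cite: AbramovichTemkinWlodarczyk2024,
§5.1 (p. 1575)] -/
theorem isCentreFor_X_pow (i : Fin N) {q : ℕ} (hq : 0 < q) :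
    IsCentreFor (X i ^ q : MvPolynomial (Fin N) k) AlgEquiv.refl (singleWeights i q) := by
  classical
  have hq' : (0 : ℚ) < q := by exact_mod_cast hq
  refine ⟨fun x => constantCoeff_X k x, fun x => ?_, fun d hd => ?_⟩
  · unfold singleWeights
    split_ifs
    · exact inv_nonneg.mpr hq'.le
    · exact le_rfl
  · change d ∈ (X i ^ q : MvPolynomial (Fin N) k).support at hd
    rw [X_pow_eq_monomial] at hd
    have hd' := support_monomial_subset hd
    rw [Finset.mem_singleton] at hd'
    subst hd'
    rw [monomialValuation, Finsupp.sum_single_index (by simp), singleWeights, if_pos rfl,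
      mul_inv_cancel₀ hq'.ne']

/-- **`max W(X_i^q) = (q)`** in any number of variables, every characteristic (`q ≥ 1`). (derived here)
[cite: AbramovichTemkinWlodarczyk2024, Thm. 5.3.1 (2) (p. 1578)] -/
theorem isMaxInv_X_pow (i : Fin N) {q : ℕ} (hq : 0 < q) :
    IsMaxInv (admissibleInvariants (X i ^ q : MvPolynomial (Fin N) k)) [(q : ℚ)] := by
  have hν : monomialOrd (fun _ => 1) (X i ^ q : MvPolynomial (Fin N) k) = q := by
    rw [X_pow_eq_monomial, monomialOrd_monomial _ _ one_ne_zero, ← Finsupp.degree_eq_weight_one,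
      Finsupp.degree_single]
  refine ⟨⟨AlgEquiv.refl, singleWeights i q, isCentreFor_X_pow i hq, exps_singleWeights i hq⟩,
    fun b hb => ?_⟩
  obtain ⟨Ψ, γ, h, rfl⟩ := hb
  rcases singleton_prefix_or_lt hν h with hpre | hlt
  · exact not_truncLex_lt_of_prefix hpre
  · exact fun h' => ATW.TruncLex.lt_irrefl _ (ATW.TruncLex.lt_trans hlt h')

/-! ## The block `X_i X_j` -/

/-- Weights of the coordinate centre `(X_i², X_j²)`, i.e. `1/2` on `i, j` (plumbing). [folklore] -/
def pairWeights (i j : Fin N) : Fin N → ℚ := fun x => if x = i ∨ x = j then (2 : ℚ)⁻¹ else 0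

/-- `exps` of the centre `(X_i², X_j²)` is `(2, 2)`. [cite: AbramovichTemkinWlodarczyk2024, §5.1 (p. 1575)] -/
theorem exps_pairWeights {i j : Fin N} (hij : i ≠ j) : exps (pairWeights i j) = [(2 : ℚ), 2] := by
  classical
  have hfilter : (Finset.univ.filter fun x => pairWeights i j x ≠ 0) = {i, j} := by
    ext x
    simp only [Finset.mem_filter, Finset.mem_univ, true_and, Finset.mem_insert, Finset.mem_singleton,
      pairWeights]
    constructor
    · intro h
      by_contra hx
      exact h (if_neg hx)
    · intro hx
      rw [if_pos hx]
      norm_num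
  have hmap : ((Finset.univ.filter fun x => pairWeights i j x ≠ 0).toList.map fun x =>
      (pairWeights i j x)⁻¹) = List.replicate 2 (2 : ℚ) := by
    rw [List.eq_replicate_iff]
    refine ⟨by rw [List.length_map, Finset.length_toList, hfilter, Finset.card_pair hij], ?_⟩
    intro b hb
    obtain ⟨x, hx, rfl⟩ := List.mem_map.1 hb
    rw [Finset.mem_toList, hfilter, Finset.mem_insert, Finset.mem_singleton] at hx
    simp [pairWeights, hx]
  unfold exps
  rw [hmap]
  rfl

/-- The coordinate centre `(X_i², X_j²)` is admissible for `X_i X_j`. [cite: AbramovichTemkinWlodarczyk2024,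
§5.1 (p. 1575)] -/
theorem isCentreFor_X_mul_X (i j : Fin N) :
    IsCentreFor (X i * X j : MvPolynomial (Fin N) k) AlgEquiv.refl (pairWeights i j) := by
  classical
  refine ⟨fun x => constantCoeff_X k x, fun x => ?_, fun d hd => ?_⟩
  · unfold pairWeights
    split_ifs
    · norm_num
    · exact le_rfl
  · change d ∈ (X i * X j : MvPolynomial (Fin N) k).support at hd
    rw [X, X, monomial_mul, mul_one] at hd
    have hd' := support_monomial_subset hd
    rw [Finset.mem_singleton] at hd'
    subst hd'
    rw [monomialValuation, Finsupp.sum_add_index' (by simp) (by intros; push_cast; ring),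
      Finsupp.sum_single_index (by simp), Finsupp.sum_single_index (by simp)]
    simp only [pairWeights, true_or, or_true, if_true, Nat.cast_one, one_mul]
    norm_num

/-- `ord (X_i X_j) = 2`. [cite: AbramovichTemkinWlodarczyk2024, §5.1 (a₁ = ord)] -/
theorem monomialOrd_X_mul_X (i j : Fin N) :
    monomialOrd (fun _ => 1) (X i * X j : MvPolynomial (Fin N) k) = 2 := by
  rw [X, X, monomial_mul, mul_one, monomialOrd_monomial _ _ one_ne_zero,
    ← Finsupp.degree_eq_weight_one, map_add, Finsupp.degree_single, Finsupp.degree_single]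
  rfl

/-- `X_i X_j` is its own initial form. [cite: CossartJannsenSaito2020, Def. 8.2] -/
theorem homogeneousComponent_X_mul_X (i j : Fin N) :
    homogeneousComponent 2 (X i * X j : MvPolynomial (Fin N) k) = X i * X j := by
  have h : (X i * X j : MvPolynomial (Fin N) k).IsHomogeneous 2 := (isHomogeneous_X k i).mul (isHomogeneous_X k j)
  rw [homogeneousComponent_of_mem h, if_pos rfl]

/-- **`τ(X_i X_j) = 2`** (`i ≠ j`), every characteristic: a translation direction `w` fixing `X_i X_j` has
`w_j = 0` (evaluate at `e_i`) and `w_i = 0` (at `e_j`). (derived here) [cite: CossartJannsenSaito2020,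
Def. 1.26 / Lemma 1.27] -/
theorem hironakaTau_X_mul_X {i j : Fin N} (hij : i ≠ j) :
    hironakaTau k {(X i * X j : MvPolynomial (Fin N) k)} = 2 := by
  classical
  refine (hironakaTau_singleton_eq_card (s := ({i, j} : Finset (Fin N))) ?_ ?_).trans
    (Finset.card_pair hij)
  · intro x hx
    rcases Finset.mem_union.1 (vars_mul _ _ hx) with h | h
    · rw [vars_X, Finset.mem_singleton] at h
      simp [h]
    · rw [vars_X, Finset.mem_singleton] at h
      simp [h]
  · intro w hw x hx
    have h0 : w i * w j = 0 := by
      have := aeval_eq_of_mem_invarianceSpace hw (fun _ => (0 : k)) 1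
      simpa using this
    have hi : w i * (1 + w j) = 0 := by
      have := aeval_eq_of_mem_invarianceSpace hw (fun y => if y = j then (1 : k) else 0) 1
      simpa [hij, hij.symm] using this
    have hj : (1 + w i) * w j = 0 := by
      have := aeval_eq_of_mem_invarianceSpace hw (fun y => if y = i then (1 : k) else 0) 1
      simpa [hij, hij.symm] using this
    have hw0 : w i = 0 ∧ w j = 0 := by
      rcases mul_eq_zero.1 h0 with h | h
      · rw [h, add_zero, one_mul] at hj
        exact ⟨h, hj⟩
      · rw [h, add_zero, mul_one] at hi
        exact ⟨hi, h⟩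
    obtain ⟨hwi, hwj⟩ := hw0
    rcases Finset.mem_insert.1 hx with rfl | hx
    · exact hwi
    · rw [Finset.mem_singleton.1 hx]; exact hwj

/-- **`max W(X_i X_j) = (2, 2)`** (`i ≠ j`) in any number of variables, every characteristic. (derived here)
[cite: AbramovichTemkinWlodarczyk2024, Thm. 5.3.1 (2) (p. 1578)] -/
theorem isMaxInv_X_mul_X {i j : Fin N} (hij : i ≠ j) :
    IsMaxInv (admissibleInvariants (X i * X j : MvPolynomial (Fin N) k)) [(2 : ℚ), 2] := by
  have hmem : [(2 : ℚ), 2] ∈ admissibleInvariants (X i * X j : MvPolynomial (Fin N) k) :=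
    ⟨AlgEquiv.refl, pairWeights i j, isCentreFor_X_mul_X i j, exps_pairWeights hij⟩
  have hτ : hironakaTau k {homogeneousComponent 2 (X i * X j : MvPolynomial (Fin N) k)} = 2 := by
    rw [homogeneousComponent_X_mul_X]; exact hironakaTau_X_mul_X hij
  have h := isMaxInv_replicate_of_mem (f := (X i * X j : MvPolynomial (Fin N) k)) (ν := 2)
    (monomialOrd_X_mul_X i j) (by rw [hτ]; exact_mod_cast hmem)
  rw [hτ] at h
  exact_mod_cast h

end Literature.AlgebraicGeometry.Resolution.WeightedBlowup

end
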